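import Literature.NumberTheory.Sieve.HybridLargeSieve
import HarnessLib

/-!
# The hybrid large sieve for Dirichlet characters on a vertical line `s = σ + it` (Huxley (19.25))

Topic `Literature/NumberTheory/Sieve`, sub-namespace `LargeSieve`. Everything here is PROVED; a small
companion of `HybridLargeSieve.lean` (Gallagher 1970, Theorem 3, `LargeSieve.hybridSieve_character`:
`∑_{q ≤ Q} (q/φ(q)) ∑*_{χ mod q} ∫_{−T}^{T} |∑_{n ∈ A} b_n χ(n) e(ν_n t)|² dt
≤ π² ∑_{n ∈ A} ((π e^π/2) n + (1 + Q²) T) |b_n|²`).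

Huxley, *The Distribution of Prime Numbers*, Ch. 19 "The hybrid sieve", (19.25), states the result
for the Dirichlet polynomial `S(s,χ) = ∑_{m ≤ N} a(m)χ(m)m^{−σ−it}` on the line `s = σ + it`:
`∫_{−T}^{T} ∑_{q ≤ Q} (q/φ(q)) ∑*_{χ mod q} |S(s,χ)|² dt ≪ ∑_{m ≤ N} (m + Q²T) |a(m)|² m^{−2σ}`. This file
derives that printed shape (explicit constant, any real `σ`, any `Q`) from the tree theorem:

* `LargeSieve.hybridSieve_character_cpow_neg` — with `n^{−it}` as the complex power
  `(n : ℂ) ^ (−(t I))` (the tree's `hybridSieve_character_cpow` has `n^{+it}` and `Q ≥ 1`);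
* `LargeSieve.hybridSieve_character_vertical` — **(19.25)**: for `T ≥ 1`, real `σ`,
  `… ∫_{−T}^{T} |∑_{n ∈ A} b_n χ(n) n^{−(σ+it)}|² dt ≤ π² ∑_{n ∈ A} ((π e^π/2) n + (1 + Q²) T) |b_n|² n^{−2σ}`;
* `LargeSieve.hybridSieve_character_moduli` — the sum restricted to a set of moduli `M ⊆ [1, Q]`
  with the weights `q/φ(q) ≥ 1` dropped (e.g. prime moduli in a window, all of whose non-principal
  characters are primitive);
* `LargeSieve.hybridSieve_character_Ioc` — coefficients on an interval `(M₀, M₀ + N]`, the classical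
  `≪ (N + Q²T) ∑ |b_n|²`.

## References
* [Huxley1972] Ch. 19, (19.13)–(19.17), (19.25); [Gallagher1970] Theorem 3.
-/

noncomputable section

open Finset Real Complex MeasureTheory
open scoped ComplexConjugate FourierTransform

namespace Literature.NumberTheory.Sieve.LargeSieve

open DirichletCharacter Literature.NumberTheory.Sieve.Gallagher

/-! ### Complex powers `n^{−it}`, `n^{−(σ+it)}` -/

/-- `n^{−it} = e(ν_n (−t))` for `n ≥ 1`. [folklore] -/
private theorem natCast_cpow_neg_mul_I {n : ℕ} (hn : 1 ≤ n) (t : ℝ) :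
    (n : ℂ) ^ (-((t : ℂ) * I)) = (𝐞 (logFreq n * (-t)) : ℂ) := by
  rw [← natCast_cpow_mul_I n hn (-t)]
  congr 1
  push_cast
  ring

open scoped Classical in
/-- **The hybrid large sieve for Dirichlet characters**, with `n^{−it}` as a complex power: for
`T ≥ 1`, a finite set `A` of naturals `n ≥ 1` and any complex `b_n`,
`∑_{q ≤ Q} (q/φ(q)) ∑*_{χ mod q} ∫_{−T}^{T} |∑_{n ∈ A} b_n χ(n) n^{−it}|² dt
  ≤ π² ∑_{n ∈ A} ((π e^π/2) n + (1 + Q²) T) |b_n|²`. [cite: Huxley1972, Ch. 19 (19.25)] -/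
theorem hybridSieve_character_cpow_neg (Q : ℕ) {T : ℝ} (hT : 1 ≤ T) (A : Finset ℕ)
    (hA : ∀ n ∈ A, 1 ≤ n) (b : ℕ → ℂ) :
    ∑ q ∈ Icc 1 Q, (q : ℝ) / q.totient * ∑ χ : DirichletCharacter ℂ q with χ.IsPrimitive,
        ∫ t in (-T)..T, ‖∑ n ∈ A, b n * χ n * (n : ℂ) ^ (-((t : ℂ) * I))‖ ^ 2 ≤
      π ^ 2 * ∑ n ∈ A, (π * Real.exp π / 2 * n + (1 + (Q : ℝ) ^ 2) * T) * ‖b n‖ ^ 2 := by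
  have key : ∀ (q : ℕ) (χ : DirichletCharacter ℂ q),
      ∫ t in (-T)..T, ‖∑ n ∈ A, b n * χ n * (n : ℂ) ^ (-((t : ℂ) * I))‖ ^ 2 =
        ∫ t in (-T)..T, ‖∑ n ∈ A, b n * χ n * (𝐞 (logFreq n * t) : ℂ)‖ ^ 2 := by
    intro q χ
    have h1 : (∫ t in (-T)..T, ‖∑ n ∈ A, b n * χ n * (n : ℂ) ^ (-((t : ℂ) * I))‖ ^ 2) =
        ∫ t in (-T)..T, ‖∑ n ∈ A, b n * χ n * (𝐞 (logFreq n * (-t)) : ℂ)‖ ^ 2 := by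
      refine intervalIntegral.integral_congr fun t _ => ?_
      rw [sum_congr rfl fun n hn => by rw [natCast_cpow_neg_mul_I (hA n hn) t]]
    rw [h1]
    have h2 := intervalIntegral.integral_comp_neg (a := -T) (b := T)
      (fun u : ℝ => ‖∑ n ∈ A, b n * χ n * (𝐞 (logFreq n * u) : ℂ)‖ ^ 2)
    simp only [neg_neg] at h2
    exact h2
  simp only [key]
  exact hybridSieve_character Q hT A hA b

/-- `|c · n^{−σ}|² = |c|² n^{−2σ}` for `n ≥ 1` and real `σ`. [folklore] -/
private theorem norm_mul_natCast_cpow_neg_real_sq (c : ℂ) {n : ℕ} (hn : 1 ≤ n) (σ : ℝ) :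
    ‖c * (n : ℂ) ^ (-(σ : ℂ))‖ ^ 2 = ‖c‖ ^ 2 * (n : ℝ) ^ (-(2 * σ)) := by
  have hn0 : 0 < n := hn
  rw [norm_mul, mul_pow, Complex.norm_natCast_cpow_of_pos hn0, sq ((n : ℝ) ^ (-(σ : ℂ)).re),
    ← Real.rpow_add (by exact_mod_cast hn0)]
  congr 1
  simp only [Complex.neg_re, Complex.ofReal_re]
  ring_nf

open scoped Classical in
/-- **The hybrid large sieve on a vertical line** (Huxley Ch. 19, (19.25) as printed, with an
explicit constant): for `T ≥ 1`, real `σ`, a finite set `A` of naturals `n ≥ 1` and any `b_n`,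
`∑_{q ≤ Q} (q/φ(q)) ∑*_{χ mod q} ∫_{−T}^{T} |∑_{n ∈ A} b_n χ(n) n^{−(σ+it)}|² dt
  ≤ π² ∑_{n ∈ A} ((π e^π/2) n + (1 + Q²) T) |b_n|² n^{−2σ}`. [cite: Huxley1972, Ch. 19 (19.25)] -/
theorem hybridSieve_character_vertical (Q : ℕ) {T : ℝ} (hT : 1 ≤ T) (σ : ℝ) (A : Finset ℕ)
    (hA : ∀ n ∈ A, 1 ≤ n) (b : ℕ → ℂ) :
    ∑ q ∈ Icc 1 Q, (q : ℝ) / q.totient * ∑ χ : DirichletCharacter ℂ q with χ.IsPrimitive,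
        ∫ t in (-T)..T, ‖∑ n ∈ A, b n * χ n * (n : ℂ) ^ (-((σ : ℂ) + (t : ℂ) * I))‖ ^ 2 ≤
      π ^ 2 * ∑ n ∈ A, (π * Real.exp π / 2 * n + (1 + (Q : ℝ) ^ 2) * T) *
        (‖b n‖ ^ 2 * (n : ℝ) ^ (-(2 * σ))) := by
  -- absorb `n^{−σ}` into the coefficients
  set b' : ℕ → ℂ := fun n => b n * (n : ℂ) ^ (-(σ : ℂ)) with hb'
  have hsplit : ∀ (q : ℕ) (χ : DirichletCharacter ℂ q) (t : ℝ),
      ∑ n ∈ A, b n * χ n * (n : ℂ) ^ (-((σ : ℂ) + (t : ℂ) * I)) =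
        ∑ n ∈ A, b' n * χ n * (n : ℂ) ^ (-((t : ℂ) * I)) := by
    intro q χ t
    refine sum_congr rfl fun n hn => ?_
    have hn0 : (n : ℂ) ≠ 0 := by exact_mod_cast (show n ≠ 0 by have := hA n hn; omega)
    rw [hb', neg_add, Complex.cpow_add _ _ hn0]
    ring
  have hnorm : ∀ n ∈ A, ‖b' n‖ ^ 2 = ‖b n‖ ^ 2 * (n : ℝ) ^ (-(2 * σ)) :=
    fun n hn => norm_mul_natCast_cpow_neg_real_sq (b n) (hA n hn) σ
  have h := hybridSieve_character_cpow_neg Q hT A hA b'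
  simp only [hsplit]
  refine h.trans (le_of_eq ?_)
  congr 1
  exact sum_congr rfl fun n hn => by rw [hnorm n hn]

/-! ### Restricting the moduli and dropping the weights `q/φ(q)` -/

open scoped Classical in
/-- **The hybrid large sieve over a set of moduli `M ⊆ [1, Q]`** (the weights `q/φ(q) ≥ 1` and the
moduli outside `M` dropped; for prime moduli `p` every non-principal character is primitive, so
this is the hybrid twin of the tree's `largeSieve_meanValue` for `p ∼ P`): for `T ≥ 1`, real `σ`,
`∑_{q ∈ M} ∑*_{χ mod q} ∫_{−T}^{T} |∑_{n ∈ A} b_n χ(n) n^{−(σ+it)}|² dt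
  ≤ π² ∑_{n ∈ A} ((π e^π/2) n + (1 + Q²) T) |b_n|² n^{−2σ}`. [cite: Huxley1972, Ch. 19 (19.25)] -/
theorem hybridSieve_character_moduli (M : Finset ℕ) (Q : ℕ) (hM : M ⊆ Icc 1 Q) {T : ℝ}
    (hT : 1 ≤ T) (σ : ℝ) (A : Finset ℕ) (hA : ∀ n ∈ A, 1 ≤ n) (b : ℕ → ℂ) :
    ∑ q ∈ M, ∑ χ : DirichletCharacter ℂ q with χ.IsPrimitive,
        ∫ t in (-T)..T, ‖∑ n ∈ A, b n * χ n * (n : ℂ) ^ (-((σ : ℂ) + (t : ℂ) * I))‖ ^ 2 ≤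
      π ^ 2 * ∑ n ∈ A, (π * Real.exp π / 2 * n + (1 + (Q : ℝ) ^ 2) * T) *
        (‖b n‖ ^ 2 * (n : ℝ) ^ (-(2 * σ))) := by
  have hls := hybridSieve_character_vertical Q hT σ A hA b
  have hT0 : 0 ≤ T := by linarith
  -- each inner term is non-negative
  have hI0 : ∀ (q : ℕ) (χ : DirichletCharacter ℂ q),
      0 ≤ ∫ t in (-T)..T, ‖∑ n ∈ A, b n * χ n * (n : ℂ) ^ (-((σ : ℂ) + (t : ℂ) * I))‖ ^ 2 :=
    fun q χ => intervalIntegral.integral_nonneg (by linarith) fun t _ => sq_nonneg _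
  have hX0 : ∀ q : ℕ, 0 ≤ ∑ χ : DirichletCharacter ℂ q with χ.IsPrimitive,
      ∫ t in (-T)..T, ‖∑ n ∈ A, b n * χ n * (n : ℂ) ^ (-((σ : ℂ) + (t : ℂ) * I))‖ ^ 2 :=
    fun q => sum_nonneg fun χ _ => hI0 q χ
  refine le_trans ?_ (le_trans (sum_le_sum_of_subset_of_nonneg hM fun q _ _ => ?_) hls)
  · refine sum_le_sum fun q hq => ?_
    have hq1 : 1 ≤ q := (mem_Icc.1 (hM hq)).1
    have hφ : (0 : ℝ) < q.totient := by exact_mod_cast Nat.totient_pos.2 hq1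
    have hw : (1 : ℝ) ≤ (q : ℝ) / q.totient := by
      rw [le_div_iff₀ hφ, one_mul]; exact_mod_cast Nat.totient_le q
    calc ∑ χ : DirichletCharacter ℂ q with χ.IsPrimitive,
          ∫ t in (-T)..T, ‖∑ n ∈ A, b n * χ n * (n : ℂ) ^ (-((σ : ℂ) + (t : ℂ) * I))‖ ^ 2
        = 1 * ∑ χ : DirichletCharacter ℂ q with χ.IsPrimitive,
          ∫ t in (-T)..T, ‖∑ n ∈ A, b n * χ n * (n : ℂ) ^ (-((σ : ℂ) + (t : ℂ) * I))‖ ^ 2 :=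
          (one_mul _).symm
      _ ≤ _ := mul_le_mul_of_nonneg_right hw (hX0 q)
  · exact mul_nonneg (by positivity) (hX0 q)

open scoped Classical in
/-- **The hybrid large sieve on an interval** (the classical shape `≪ (N + Q²T) ∑|b_n|²`): for
`T ≥ 1` and coefficients on `M₀ < n ≤ M₀ + N`,
`∑_{q ≤ Q} (q/φ(q)) ∑*_{χ mod q} ∫_{−T}^{T} |∑_n b_n χ(n) n^{−it}|² dt
  ≤ π² ((π e^π/2)(M₀ + N) + (1 + Q²) T) ∑_n |b_n|²`. [cite: Huxley1972, Ch. 19 (19.25)] -/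
theorem hybridSieve_character_Ioc (Q M₀ N : ℕ) {T : ℝ} (hT : 1 ≤ T) (b : ℕ → ℂ) :
    ∑ q ∈ Icc 1 Q, (q : ℝ) / q.totient * ∑ χ : DirichletCharacter ℂ q with χ.IsPrimitive,
        ∫ t in (-T)..T, ‖∑ n ∈ Ioc M₀ (M₀ + N), b n * χ n * (n : ℂ) ^ (-((t : ℂ) * I))‖ ^ 2 ≤
      π ^ 2 * (π * Real.exp π / 2 * ((M₀ : ℝ) + N) + (1 + (Q : ℝ) ^ 2) * T) *
        ∑ n ∈ Ioc M₀ (M₀ + N), ‖b n‖ ^ 2 := by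
  have hA : ∀ n ∈ Ioc M₀ (M₀ + N), 1 ≤ n := fun n hn => by rw [mem_Ioc] at hn; omega
  refine (hybridSieve_character_cpow_neg Q hT _ hA b).trans ?_
  have hc : 0 ≤ π * Real.exp π / 2 := by positivity
  have hsum : ∑ n ∈ Ioc M₀ (M₀ + N), (π * Real.exp π / 2 * n + (1 + (Q : ℝ) ^ 2) * T) * ‖b n‖ ^ 2 ≤
      (π * Real.exp π / 2 * ((M₀ : ℝ) + N) + (1 + (Q : ℝ) ^ 2) * T) *
        ∑ n ∈ Ioc M₀ (M₀ + N), ‖b n‖ ^ 2 := by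
    rw [Finset.mul_sum]
    refine sum_le_sum fun n hn => ?_
    have hnle : (n : ℝ) ≤ (M₀ : ℝ) + N := by
      rw [mem_Ioc] at hn; exact_mod_cast hn.2
    have hb : 0 ≤ ‖b n‖ ^ 2 := by positivity
    exact mul_le_mul_of_nonneg_right (add_le_add (mul_le_mul_of_nonneg_left hnle hc) le_rfl) hb
  calc π ^ 2 * ∑ n ∈ Ioc M₀ (M₀ + N), (π * Real.exp π / 2 * n + (1 + (Q : ℝ) ^ 2) * T) * ‖b n‖ ^ 2
      ≤ π ^ 2 * ((π * Real.exp π / 2 * ((M₀ : ℝ) + N) + (1 + (Q : ℝ) ^ 2) * T) *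
          ∑ n ∈ Ioc M₀ (M₀ + N), ‖b n‖ ^ 2) := mul_le_mul_of_nonneg_left hsum (by positivity)
    _ = _ := by ring

end Literature.NumberTheory.Sieve.LargeSieve
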